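import Literature.AlgebraicGeometry.Frobenioids.Categories
import Mathlib.CategoryTheory.Widesubcategory
import HarnessLib

/-!
# [FrdI] Prop. 1.6 (vi) «Aut^sub-ample» counterexample, part 1: the base category `D` and `D′ ⊂ D`

Mochizuki, *The geometry of Frobenioids I: the general theory*, Kyushu J. Math. **62** (2008)
293–400, §1, Proposition 1.6 (vi), kurims text p. 27 [cite: MochizukiFrdI2008, Prop. 1.6(vi) p.27]:

> "(vi) A object of `C′` is Aut-ample (respectively, Aut^sub-ample; End-ample) if it projects to
> such an object of `C`."

OURS (abc-iut cell, finding F-w5d202-1; NOT a construction of the paper): a kernel witness that the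
clause «Aut^sub-ample» (direction `C ⇒ C′`, `C′ := C ×_D D′`) is FALSE AS PRINTED under the standing
hypotheses of Prop. 1.6 (p. 27: `C → F_Φ` a Frobenioid over a connected, totally epimorphic `D`, `Φ`
divisorial; `D′ → D` a functor between connected, totally epimorphic categories mapping FSM-morphisms
to FSM-morphisms).  The clauses «Aut-ample»/«End-ample» are PROVED in the tree (abc-iut-found,
`PreFrobenioid.isAutAmple_fiberProduct_of_fst` / `isEndAmple_fiberProduct_of_fst`); «Aut^sub-ample»
was left open there ("the evident lifting argument needs a sub-automorphism of the `C`-component with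
PRESCRIBED projection to `D`", `FiberProductsMorphisms.lean`).  The four files of the witness:
`AutSubAmpleCexBase` (the base `D`, the sub-category `D′`), `AutSubAmpleCexMonoids` (the lexicographic
cones `L₂`, `L₃`), `AutSubAmpleCexFrobenioid` (the divisor monoid `Φ`, `B = 0_D`, the model Frobenioid
`C`, integer coordinates on `L₂^gp`), `AutSubAmpleFiberProductCounterexample` (the objects `A`, `X` and
the refutation).  Neutral record under the cell's typing; nothing here bears on [IUTchIII] Cor. 3.12.

THIS FILE: the base category `D` — three objects `P, E₀, E₁` with `End(P) = {gʲ : j ≥ 0}`,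
`Aut(Eᵢ) = ⟨bᵢ⟩ ≅ ℤ`, `Hom(Eᵢ, P) = {χⁱₙ : n ∈ ℤ}` a `ℤ`-torsor (`χₙ ∘ bᵢ = g ∘ χₙ = χₙ₊₁`) and no
other arrows (all arrows are integer labels, composition is addition) — connected, totally epimorphic,
every endomorphism an FSM-morphism, no arrow `Eᵢ → P` fiberwise-surjective; and the wide subcategory
`D′` (same arrows except that `E₁` keeps only its identity) with its inclusion `G : D′ → D`, which maps
FSM-morphisms to FSM-morphisms.
-/

namespace Literature.AlgebraicGeometry.Frobenioids

open CategoryTheory Opposite Function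

namespace AutSubAmpleCex

/-! ### The base category `D` -/

/-- The three objects `P, E₀, E₁` of the base category `D` of the witness.
[cite: MochizukiFrdI2008, Prop. 1.6(vi) p.27] -/
inductive BObj : Type
  | P
  | E0
  | E1
  deriving DecidableEq, Inhabited

/-- Which integers label an arrow `X → Y`: `End(P) = ℕ`, `End(Eᵢ) = ℤ`, `Hom(Eᵢ, P) = ℤ`, nothing else.
[cite: MochizukiFrdI2008, Prop. 1.6(vi) p.27] -/
def HomValid : BObj → BObj → ℤ → Prop
  | .P, .P, n => 0 ≤ n
  | .E0, .E0, _ => True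
  | .E1, .E1, _ => True
  | .E0, .P, _ => True
  | .E1, .P, _ => True
  | .P, .E0, _ => False
  | .P, .E1, _ => False
  | .E0, .E1, _ => False
  | .E1, .E0, _ => False

/-- Arrows of `D`: labelled by integers. [cite: MochizukiFrdI2008, Prop. 1.6(vi) p.27] -/
@[ext] structure BHom (X Y : BObj) : Type where
  /-- the integer label -/
  val : ℤ
  /-- the label is admissible -/
  valid : HomValid X Y val

/-- Identities are admissible. [cite: MochizukiFrdI2008, Prop. 1.6(vi) p.27] -/
theorem homValid_zero (X : BObj) : HomValid X X 0 := by
  cases X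
  · exact le_rfl
  · trivial
  · trivial

/-- An endomorphism label of `Y` is an endomorphism label of any `X` mapping to `Y`.
[cite: MochizukiFrdI2008, Prop. 1.6(vi) p.27] -/
theorem homValid_endo {X Y : BObj} {m n : ℤ} (hm : HomValid X Y m) (hn : HomValid Y Y n) :
    HomValid X X n := by
  cases X <;> cases Y <;> first | exact hn | trivial

/-- Composites are admissible. [cite: MochizukiFrdI2008, Prop. 1.6(vi) p.27] -/
theorem homValid_add {X Y Z : BObj} {m n : ℤ} (hm : HomValid X Y m) (hn : HomValid Y Z n) :
    HomValid X Z (m + n) := by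
  cases X <;> cases Y <;> cases Z <;> first | exact add_nonneg hm hn | trivial

/-- `D` is a category: composition is addition of labels. [cite: MochizukiFrdI2008, Prop. 1.6(vi) p.27] -/
instance : SmallCategory BObj where
  Hom X Y := BHom X Y
  id X := ⟨0, homValid_zero X⟩
  comp f g := ⟨f.val + g.val, homValid_add f.valid g.valid⟩
  id_comp _ := BHom.ext (zero_add _)
  comp_id _ := BHom.ext (add_zero _)
  assoc _ _ _ := BHom.ext (add_assoc _ _ _)

/-- Labels of identities. [cite: MochizukiFrdI2008, Prop. 1.6(vi) p.27] -/
@[simp] theorem id_val (X : BObj) : BHom.val (𝟙 X) = 0 := rfl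

/-- Labels of composites. [cite: MochizukiFrdI2008, Prop. 1.6(vi) p.27] -/
@[simp] theorem comp_val {X Y Z : BObj} (f : X ⟶ Y) (g : Y ⟶ Z) :
    BHom.val (f ≫ g) = f.val + g.val := rfl

/-- Extensionality of arrows of `D` through labels. [cite: MochizukiFrdI2008, Prop. 1.6(vi) p.27] -/
theorem hom_ext {X Y : BObj} {f g : X ⟶ Y} (h : f.val = g.val) : f = g := BHom.ext h

/-- The arrow `X → Y` with label `n`. [cite: MochizukiFrdI2008, Prop. 1.6(vi) p.27] -/
def ar (X Y : BObj) (n : ℤ) (h : HomValid X Y n) : X ⟶ Y := ⟨n, h⟩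

/-- Label of `ar`. [cite: MochizukiFrdI2008, Prop. 1.6(vi) p.27] -/
@[simp] theorem ar_val (X Y : BObj) (n : ℤ) (h : HomValid X Y n) : (ar X Y n h).val = n := rfl

/-- There are no arrows `P → E₀`. [cite: MochizukiFrdI2008, Prop. 1.6(vi) p.27] -/
theorem no_P_E0 (f : BObj.P ⟶ BObj.E0) : False := f.valid

/-- There are no arrows `P → E₁`. [cite: MochizukiFrdI2008, Prop. 1.6(vi) p.27] -/
theorem no_P_E1 (f : BObj.P ⟶ BObj.E1) : False := f.valid

/-- There are no arrows `E₀ → E₁`. [cite: MochizukiFrdI2008, Prop. 1.6(vi) p.27] -/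
theorem no_E0_E1 (f : BObj.E0 ⟶ BObj.E1) : False := f.valid

/-- There are no arrows `E₁ → E₀`. [cite: MochizukiFrdI2008, Prop. 1.6(vi) p.27] -/
theorem no_E1_E0 (f : BObj.E1 ⟶ BObj.E0) : False := f.valid

/-- Labels of endomorphisms of `P` are non-negative. [cite: MochizukiFrdI2008, Prop. 1.6(vi) p.27] -/
theorem P_val_nonneg (f : BObj.P ⟶ BObj.P) : 0 ≤ f.val := f.valid

/-- Every arrow of `D` is an epimorphism. [cite: MochizukiFrdI2008, Prop. 1.6(vi) p.27] -/
theorem isTotallyEpimorphic : IsTotallyEpimorphic BObj :=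
  ⟨fun f => ⟨fun g h w => hom_ext (by have := congrArg BHom.val w; simp only [comp_val] at this; omega)⟩⟩

/-- Every arrow of `D` is a monomorphism. [cite: MochizukiFrdI2008, Prop. 1.6(vi) p.27] -/
theorem isMono {X Y : BObj} (f : X ⟶ Y) : Mono f :=
  ⟨fun g h w => hom_ext (by have := congrArg BHom.val w; simp only [comp_val] at this; omega)⟩

/-- The arrow `X → P` with label `0`. [cite: MochizukiFrdI2008, Prop. 1.6(vi) p.27] -/
def toP : ∀ X : BObj, X ⟶ BObj.P
  | .P => ⟨0, le_rfl⟩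
  | .E0 => ⟨0, trivial⟩
  | .E1 => ⟨0, trivial⟩

/-- `D` is connected. [cite: MochizukiFrdI2008, Prop. 1.6(vi) p.27] -/
theorem isGraphConnected : IsGraphConnected BObj :=
  ⟨⟨BObj.P⟩, fun X Y => (Zigzag.of_hom (toP X)).trans (Zigzag.of_inv (toP Y))⟩

/-- Every endomorphism of `D` is fiberwise-surjective (hence an FSM-morphism).
[cite: MochizukiFrdI2008, Prop. 1.6(vi) p.27] -/
theorem isFSM_endo {Y : BObj} (f : Y ⟶ Y) : IsFSM f :=
  ⟨fun X γ => ⟨X, γ, ⟨f.val, homValid_endo γ.valid f.valid⟩, hom_ext (add_comm _ _)⟩, isMono f⟩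

/-- An arrow `E₀ → P` is not fiberwise-surjective: `E₀` and `E₁` have no common source.
[cite: MochizukiFrdI2008, Prop. 1.6(vi) p.27] -/
theorem not_isFiberwiseSurjective_E0 (f : BObj.E0 ⟶ BObj.P) : ¬ IsFiberwiseSurjective f := by
  intro h
  obtain ⟨Z, δB, δX, -⟩ := h (toP BObj.E1)
  cases Z
  · exact no_P_E0 δB
  · exact no_E0_E1 δX
  · exact no_E1_E0 δB

/-- An arrow `E₁ → P` is not fiberwise-surjective. [cite: MochizukiFrdI2008, Prop. 1.6(vi) p.27] -/
theorem not_isFiberwiseSurjective_E1 (f : BObj.E1 ⟶ BObj.P) : ¬ IsFiberwiseSurjective f := by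
  intro h
  obtain ⟨Z, δB, δX, -⟩ := h (toP BObj.E0)
  cases Z
  · exact no_P_E1 δB
  · exact no_E0_E1 δB
  · exact no_E1_E0 δX

/-! ### The sub-category `D′` (no automorphisms of `E₁` but the identity) -/

/-- The arrows of `D′`: all arrows of `D` except the non-identity automorphisms of `E₁`.
[cite: MochizukiFrdI2008, Prop. 1.6(vi) p.27] -/
def W : MorphismProperty BObj := fun X Y f =>
  match X, Y with
  | .E1, .E1 => f.val = 0
  | _, _ => True

/-- `W` contains the identities and is stable under composition. [cite: MochizukiFrdI2008, Prop. 1.6(vi) p.27] -/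
instance : W.IsMultiplicative where
  id_mem X := by
    cases X
    · trivial
    · trivial
    · rfl
  comp_mem {X Y Z} f g hf hg := by
    cases X <;> cases Y <;> cases Z <;>
      first
      | trivial
      | exact (no_P_E1 g).elim
      | exact (no_E1_E0 f).elim
      | exact (show f.val + g.val = 0 by rw [show f.val = 0 from hf, show g.val = 0 from hg]; rfl)

/-- `D′`, a wide subcategory of `D`. [cite: MochizukiFrdI2008, Prop. 1.6(vi) p.27] -/
abbrev D' : Type := WideSubcategory W

/-- The inclusion `D′ → D`. [cite: MochizukiFrdI2008, Prop. 1.6(vi) p.27] -/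
abbrev G : D' ⥤ BObj := wideSubcategoryInclusion W

/-- `D′` is totally epimorphic. [cite: MochizukiFrdI2008, Prop. 1.6(vi) p.27] -/
theorem isTotallyEpimorphic_D' : IsTotallyEpimorphic D' :=
  ⟨fun f => ⟨fun g h w => by
    apply WideSubcategory.hom_ext
    have w' := congrArg InducedWideCategory.Hom.hom w
    simp only [WideSubcategory.comp_def] at w'
    haveI := isTotallyEpimorphic.epi f.hom
    exact (cancel_epi f.hom).mp w'⟩⟩

/-- The arrow `X → P` with label `0`, in `D′`. [cite: MochizukiFrdI2008, Prop. 1.6(vi) p.27] -/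
def toP' (X : D') : X ⟶ ⟨BObj.P⟩ :=
  ⟨toP X.obj, by
    rcases X with ⟨X⟩
    cases X
    · trivial
    · trivial
    · trivial⟩

/-- `D′` is connected. [cite: MochizukiFrdI2008, Prop. 1.6(vi) p.27] -/
theorem isGraphConnected_D' : IsGraphConnected D' :=
  ⟨⟨⟨BObj.P⟩⟩, fun X Y => (Zigzag.of_hom (toP' X)).trans (Zigzag.of_inv (toP' Y))⟩

/-- An arrow `E₀ → P` of `D′` is not fiberwise-surjective in `D′` either.
[cite: MochizukiFrdI2008, Prop. 1.6(vi) p.27] -/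
theorem not_isFiberwiseSurjective_E0' (f : (⟨BObj.E0⟩ : D') ⟶ ⟨BObj.P⟩) :
    ¬ IsFiberwiseSurjective f := by
  intro h
  obtain ⟨Z, δB, δX, -⟩ := h (toP' ⟨BObj.E1⟩)
  rcases Z with ⟨Z⟩
  cases Z
  · exact no_P_E0 δB.hom
  · exact no_E0_E1 δX.hom
  · exact no_E1_E0 δB.hom

/-- An arrow `E₁ → P` of `D′` is not fiberwise-surjective in `D′`. [cite: MochizukiFrdI2008, Prop. 1.6(vi) p.27] -/
theorem not_isFiberwiseSurjective_E1' (f : (⟨BObj.E1⟩ : D') ⟶ ⟨BObj.P⟩) :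
    ¬ IsFiberwiseSurjective f := by
  intro h
  obtain ⟨Z, δB, δX, -⟩ := h (toP' ⟨BObj.E0⟩)
  rcases Z with ⟨Z⟩
  cases Z
  · exact no_P_E1 δB.hom
  · exact no_E0_E1 δB.hom
  · exact no_E1_E0 δX.hom

/-- The inclusion `D′ → D` maps FSM-morphisms to FSM-morphisms (hypothesis of Prop. 1.6).
[cite: MochizukiFrdI2008, Prop. 1.6(vi) p.27] -/
theorem map_isFSM {a b : D'} (f : a ⟶ b) (hf : IsFSM f) : IsFSM (G.map f) := by
  rcases a with ⟨a⟩; rcases b with ⟨b⟩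
  change IsFSM f.hom
  cases a <;> cases b
  · exact isFSM_endo _
  · exact (no_P_E0 f.hom).elim
  · exact (no_P_E1 f.hom).elim
  · exact (not_isFiberwiseSurjective_E0' f hf.1).elim
  · exact isFSM_endo _
  · exact (no_E0_E1 f.hom).elim
  · exact (not_isFiberwiseSurjective_E1' f hf.1).elim
  · exact (no_E1_E0 f.hom).elim
  · exact isFSM_endo _

end AutSubAmpleCex

end Literature.AlgebraicGeometry.Frobenioids
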